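import Summits.AtomisticToContinuum.BoseEinsteinCondensation.Theorems.BECInsertionCorrectorStaticResponseBoundEcsfToTorusHyperuniformity
import Summits.AtomisticToContinuum.BoseEinsteinCondensation.Theorems.BECInsertionCorrectorStaticResponseBoundModulationToolkit
import HarnessLib

/-!
# The infrared half and the near-minimiser moment bound imply torus hyperuniformity (stmt-9093)

Helper file for the crux `BECInsertionCorrector.StaticResponseBound`
(item stmt-AtomisticToContinuum-12057; this file supports, does not close, the item), line
`uv-thomson-force-wave` (seat c1), registered stub `stub_torusHyperuniformityPackaging` of the
checked skeleton `Cruxes/StaticResponseBound` v4.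

Hypothesis 1 (IH) is the INFRARED HALF of the crux: for every window parameter `M₀ > 0` there are
`ρ₀, C > 0` with the crux's inner inequality `Ineq v C ρ N k t Ψ`
(`E₀ − C t² N / max(ρa, |p|²) ≤ E_Ψ + t⟨∑ⱼcos(p·xⱼ)⟩_Ψ`) for `0 < ρ < ρ₀`, ALL `N ≥ 1`, all modes
`k ≠ 0` with `|p|² ≤ M₀² ρa` in the thermodynamic box `L = (N/ρ)^{1/3}`, all `t` and all
finite-energy periodic states.  Hypothesis 2 (NM) is the near-minimiser COS² moment bound at fixed
`(N, L)`: the discriminant family `E₀ − Bt² ≤ E_Ψ + t⟨∑cos⟩_Ψ` at a mode `k ≠ 0`, `|p|² ≤ P`,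
forces `∫(∑ⱼcos(p·xⱼ))²|Φ|² ≤ 2√(B N |p|²) + ε` for every `δ(ε)`-near-minimiser `Φ`.
The conclusion is VERBATIM the sibling route's open crux
`BECSectorPoincareTwoScale.TorusHyperuniformity` (stmt-AtomisticToContinuum-9093).

Proof (`stub_torusHyperuniformityPackaging`).  Given `(v, M₀)` apply IH at `(v, 2M₀)` (output
`ρ_I, C_I`), let `ρ₁` be a finiteness density of `v`
(`ecsf9093_periodicGroundStateEnergy_ne_top`), and answer with `C := 6√(2 C_I) + 1`,
`ρ₀ := min(ρ_I/2, ρ₁/2)`; the claim is proved for ALL `N ≥ 1`.  For a box `L` in the density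
window put `ρ' := N/L³ ∈ [ρ/2, 2ρ]`; `sideLength ρ' N = L` (`ecsf9093_sideLength_eq`), so IH at
density `ρ'` speaks about the states of the box `L`, and since `max(ρ'a, |p|²) ≥ ρ'a > 0` it gives
NM's hypothesis family with `B := C_I N/(ρ'a)` uniformly in the window `|p|² ≤ P := (2M₀)² ρ'a`
(which contains `k ≤ M₀√(ρa)` as `ρ ≤ 2ρ'`).  NM at `ε := (2π/L)√(B N) ≤ √(B N |p|²)` yields `δ`;
for a `δ`-near-minimiser `Ψ` the COS² moment is `≤ 3√(B N |p|²)`, and so is the SIN² moment: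
translating all bosons by a quarter wavelength `τ = L k/(4|k|²)` (`p·τ = π/2`,
`cos(θ + π/2) = −sin θ`) gives a state of the same energy whose COS² moment is the SIN² moment of
`Ψ` (`thp_exists_translate_sin_sq`, shift of the fundamental cell).  Finally
`|∑ⱼe^{iθⱼ}|² = (∑cos θⱼ)² + (∑ sin θⱼ)²` (`thp_norm_densityWave_sq`), `inf_c ≤` value at `c = 0`,
and `6√(B N|p|²) = 6√C_I N|p|/√(ρ'a) ≤ 6√(2C_I) N |p|/√(ρa)` (`thp_arith`).  If `a = 0` the window
is empty.

References: the skeleton (above); L. Reatto, G. V. Chester, Phys. Rev. 155 (1967) 88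
(hyperuniformity `S(k) ∼ |k|/(2mc)`); R. P. Feynman, Phys. Rev. 94 (1954) 262 (`k²/S(k)`).
-/

noncomputable section

namespace Summit.AtomisticToContinuum.BoseEinsteinCondensation.Cruxes.StaticResponseBound.UvThomsonForceWave

open MeasureTheory Filter
open scoped ENNReal NNReal BigOperators Topology
open Literature.MathematicalPhysics.QuantumManyBody.BoseGas
open Summit.AtomisticToContinuum.BoseEinsteinCondensation.Theses
open Summit.AtomisticToContinuum.BoseEinsteinCondensation.Theses.BECInsertionCorrector
open Summit.AtomisticToContinuum.BoseEinsteinCondensation.Theorems.StaticResponseBound.Negative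
open Summit.AtomisticToContinuum.BoseEinsteinCondensation.Cruxes.StaticResponseBound.StableFractionSquareCompletion

variable {N : ℕ} {L : ℝ}

/-! ## The quarter-wavelength translation: the `sin²` moment is a `cos²` moment -/

/-- **Quarter-wavelength translation.** For `k ≠ 0`, translating all bosons by
`τ = (L/4|k|²) k` (so that `p·τ = π/2`, `p = 2πk/L`) maps a periodic trial state `Φ` to a periodic
trial state `Ψ = Φ(· - τ𝟙)` with the same energy (for every pair potential) whose COS² moment of
the density wave is the SIN² moment of `Φ`:
`∫(∑ⱼcos(p·xⱼ))²|Ψ|² = ∫(∑ⱼsin(p·xⱼ))²|Φ|²` (shift of the fundamental cell,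
`cos(θ + π/2) = -sin θ`). [folklore] -/
theorem thp_exists_translate_sin_sq (hL : 0 < L) {k : Fin 3 → ℤ} (hk : k ≠ 0)
    (Φ : PeriodicTrialState N L) :
    ∃ Ψ : PeriodicTrialState N L, (∀ v : ℝ → ℝ≥0∞, periodicEnergy v Ψ = periodicEnergy v Φ) ∧
      ∫ X in cellN N L, (∑ j, Real.cos (2 * Real.pi / L * ∑ i, (k i : ℝ) * X j i)) ^ 2 * ‖Ψ.ψ X‖ ^ 2 =
        ∫ X in cellN N L, (∑ j, Real.sin (2 * Real.pi / L * ∑ i, (k i : ℝ) * X j i)) ^ 2 *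
          ‖Φ.ψ X‖ ^ 2 := by
  -- adapted from `exists_translate_cosMean_eq_neg` (…StaticResponseBoundModulationToolkit)
  set κ : ℝ := ∑ i, (k i : ℝ) ^ 2 with hκ
  have hκpos : 0 < κ := by
    obtain ⟨i, hi⟩ : ∃ i, k i ≠ 0 := by
      by_contra h
      push Not at h
      exact hk (funext h)
    have hi' : (0 : ℝ) < (k i : ℝ) ^ 2 := by
      have : (k i : ℝ) ≠ 0 := by exact_mod_cast hi
      positivity
    exact Finset.sum_pos' (fun j _ => sq_nonneg _) ⟨i, Finset.mem_univ _, hi'⟩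
  set τ : Space := WithLp.toLp 2 fun i => L / (4 * κ) * (k i : ℝ) with hτ
  obtain ⟨Ψ, hΨ⟩ := Φ.exists_translate τ
  refine ⟨Ψ, fun v => periodicEnergy_translate v Φ τ hΨ, ?_⟩
  show ∫ X in cellN N L, (∑ j, Real.cos (arg L k (X j))) ^ 2 * ‖Ψ.ψ X‖ ^ 2 =
    ∫ X in cellN N L, (∑ j, Real.sin (arg L k (X j))) ^ 2 * ‖Φ.ψ X‖ ^ 2
  have hphase : ∀ x : Space, arg L k (x + τ) = arg L k x + Real.pi / 2 := by
    intro x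
    have hsum : ∑ i, (k i : ℝ) * (x + τ) i = (∑ i, (k i : ℝ) * x i) + L / (4 * κ) * κ := by
      rw [hκ, Finset.mul_sum, ← Finset.sum_add_distrib]
      refine Finset.sum_congr rfl fun i _ => ?_
      rw [PiLp.add_apply, hτ, PiLp.toLp_apply]
      ring
    unfold arg
    rw [hsum, mul_add]
    congr 1
    field_simp
    ring
  -- the shifted integrand
  set G : Config N → ℝ := fun X =>
    (∑ j, Real.cos (arg L k ((X + fun _ => τ : Config N) j))) ^ 2 * ‖Φ.ψ X‖ ^ 2 with hG
  have hGper : ∀ (X : Config N) (i : Fin N) (a : Fin 3),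
      G (X + Pi.single i (EuclideanSpace.single a L)) = G X := by
    intro X i a
    simp only [hG]
    rw [Φ.periodic X i a, add_right_comm, sum_cos_add_single hL.ne' k]
  have hsum_eq : ∀ X : Config N,
      ∑ j, Real.cos (arg L k ((X + fun _ => τ : Config N) j)) = -∑ j, Real.sin (arg L k (X j)) := by
    intro X
    rw [← Finset.sum_neg_distrib]
    refine Finset.sum_congr rfl fun j _ => ?_
    rw [Pi.add_apply, hphase, Real.cos_add_pi_div_two]
  have hlhs : ∫ X in cellN N L, (∑ j, Real.cos (arg L k (X j))) ^ 2 * ‖Ψ.ψ X‖ ^ 2 =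
      ∫ X in cellN N L, G (X + -fun _ => τ) := by
    rw [hΨ]
    congr 1 with X
    simp only [hG, sub_eq_add_neg, Pi.add_apply, Pi.neg_apply, neg_add_cancel_right]
  rw [hlhs, setIntegral_cellN_comp_add hL hGper]
  congr 1 with X
  simp only [hG]
  rw [hsum_eq, neg_sq]

/-! ## Pointwise: `|ρ̂_p|² = (∑cos)² + (∑sin)²` -/

/-- `|∑ⱼ e^{iθⱼ}|² = (∑ⱼ cos θⱼ)² + (∑ⱼ sin θⱼ)²` for the density wave
`ρ̂_p(X) = ∑ⱼ e^{ip·xⱼ}`, `θⱼ = (2π/L)∑ₜ mₜ (xⱼ)ₜ`. [folklore] -/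
theorem thp_norm_densityWave_sq (L : ℝ) (m : Fin 3 → ℤ) (X : Config N) :
    ‖densityWave N L m X‖ ^ 2 =
      (∑ j, Real.cos (2 * Real.pi / L * ∑ t, (m t : ℝ) * X j t)) ^ 2 +
        (∑ j, Real.sin (2 * Real.pi / L * ∑ t, (m t : ℝ) * X j t)) ^ 2 := by
  have hre : ∀ θ : ℝ, (Complex.exp (Complex.I * θ)).re = Real.cos θ := fun θ => by
    rw [mul_comm, Complex.exp_ofReal_mul_I_re]
  have him : ∀ θ : ℝ, (Complex.exp (Complex.I * θ)).im = Real.sin θ := fun θ => by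
    rw [mul_comm, Complex.exp_ofReal_mul_I_im]
  rw [densityWave, Complex.sq_norm, Complex.normSq_apply, Complex.re_sum, Complex.im_sum]
  simp only [hre, him]
  ring

/-! ## Window arithmetic -/

/-- **The window arithmetic of the packaging** (pure real variables): with `S = √(ρa)`,
`S' = √(ρ'a)`, `S ≤ √2 S'` (density window `ρ ≤ 2ρ'`), `s_P = |p|`:
`6 · (√C_I N s_P / S') ≤ (6√(2C_I) + 1) N s_P / S`. [folklore] -/
theorem thp_arith {CI Nr sP S S' : ℝ} (hNr : 0 ≤ Nr) (hsP : 0 ≤ sP) (hS : 0 < S)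
    (hS' : 0 < S') (hSS' : S ≤ Real.sqrt 2 * S') :
    6 * (Real.sqrt CI * Nr * sP / S') ≤ (6 * Real.sqrt (2 * CI) + 1) * Nr * sP / S := by
  rw [Real.sqrt_mul (by norm_num : (0 : ℝ) ≤ 2), mul_div_assoc', div_le_div_iff₀ hS' hS]
  have hX : 0 ≤ Real.sqrt CI * Nr * sP := by positivity
  have h1 : Real.sqrt CI * Nr * sP * S ≤ Real.sqrt CI * Nr * sP * (Real.sqrt 2 * S') :=
    mul_le_mul_of_nonneg_left hSS' hX
  have h2 : 0 ≤ Nr * sP * S' := by positivity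
  nlinarith [h1, h2]

/-! ## The packaging: IH ∧ NM ⟹ `TorusHyperuniformity` (stmt-9093) -/

/-- **Registered stub `stub_torusHyperuniformityPackaging` (line `uv-thomson-force-wave`, seat c1).**
The infrared half of the crux (all `N ≥ 1`, exact density) and the near-minimiser COS² moment
bound at fixed volume imply `BECSectorPoincareTwoScale.TorusHyperuniformity`
(stmt-AtomisticToContinuum-9093) BY NAME: IH at `(v, 2M₀)` ↦ `(ρ_I, C_I)`, Ruelle finiteness
`ρ₁`, `C := 6√(2C_I) + 1`, `ρ₀ := min(ρ_I/2, ρ₁/2)`, all `N ≥ 1`; in the window `ρ' := N/L³`,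
`sideLength ρ' N = L`, `B := C_I N/(ρ'a)`, `P := (2M₀)²ρ'a`, NM at `ε := (2π/L)√(BN)`, the
quarter-wavelength translate for the `sin²` half, `|ρ̂_p|² = (∑cos)² + (∑sin)²`, `inf_c ≤` value at
`c = 0`, and `6√(BN|p|²) ≤ C N|p|/√(ρa)`; `a = 0` makes the window empty. [folklore] -/
theorem stub_torusHyperuniformityPackaging :
    (∀ v : ℝ → ℝ≥0∞, IsRepulsiveFiniteRange v → ∀ M₀ : ℝ, 0 < M₀ →
      ∃ ρ₀ : ℝ, 0 < ρ₀ ∧ ∃ C : ℝ, 0 < C ∧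
        ∀ ρ : ℝ, 0 < ρ → ρ < ρ₀ → ∀ N : ℕ, 0 < N → ∀ k : Fin 3 → ℤ, k ≠ 0 →
          psq (sideLength ρ N) k ≤ M₀ ^ 2 * (ρ * (scatteringLength v).toReal) →
          ∀ t : ℝ, ∀ Ψ : PeriodicTrialState N (sideLength ρ N), periodicEnergy v Ψ ≠ ⊤ →
            Ineq v C ρ N k t Ψ) →
    (∀ (v : ℝ → ℝ≥0∞) (N : ℕ) (L : ℝ), 0 < L → ∀ (B P : ℝ), 0 ≤ B → 0 ≤ P →
      periodicGroundStateEnergy v N L ≠ ⊤ →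
      ∀ ε : ℝ, 0 < ε → ∃ δ : ℝ, 0 < δ ∧ ∀ k : Fin 3 → ℤ, k ≠ 0 → psq L k ≤ P →
        (∀ (t : ℝ) (Ψ : PeriodicTrialState N L), periodicEnergy v Ψ ≠ ⊤ →
          (periodicGroundStateEnergy v N L).toReal - B * t ^ 2 ≤
            (periodicEnergy v Ψ).toReal + t * cosMean L k Ψ) →
        ∀ Φ : PeriodicTrialState N L,
          periodicEnergy v Φ ≤ periodicGroundStateEnergy v N L + ENNReal.ofReal δ →
          ∫ X in cellN N L, (∑ j, Real.cos (2 * Real.pi / L * ∑ i, (k i : ℝ) * X j i)) ^ 2 * ‖Φ.ψ X‖ ^ 2 ≤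
            2 * Real.sqrt (B * (N * psq L k)) + ε) →
    BECSectorPoincareTwoScale.TorusHyperuniformity := by
  intro hIH hNM v hv M₀ hM₀
  obtain ⟨ρI, hρI, C_I, hCI, hIH'⟩ := hIH v hv (2 * M₀) (by positivity)
  obtain ⟨ρ₁, hρ₁, hfin⟩ := ecsf9093_periodicGroundStateEnergy_ne_top hv
  refine ⟨6 * Real.sqrt (2 * C_I) + 1, by positivity, min (ρI / 2) (ρ₁ / 2),
    lt_min (by positivity) (by positivity), fun ρ hρ hρlt => ?_⟩
  have hρI2 : ρ < ρI / 2 := hρlt.trans_le (min_le_left _ _)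
  have hρ₁2 : ρ < ρ₁ / 2 := hρlt.trans_le (min_le_right _ _)
  refine Filter.eventually_atTop.2 ⟨1, ?_⟩
  intro N hN L hL hlo hhi
  have hN0 : 0 < N := hN
  have hNr : (0 : ℝ) < N := by exact_mod_cast hN0
  have hL3 : 0 < L ^ 3 := by positivity
  -- the density of the box `L` and the identification of the boxes
  obtain ⟨ρ', hρ'⟩ : ∃ ρ' : ℝ, ρ' = (N : ℝ) / L ^ 3 := ⟨_, rfl⟩
  rw [← hρ'] at hlo hhi
  have hρ'pos : 0 < ρ' := by linarith
  have hρ'I : ρ' < ρI := by linarith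
  have hside : sideLength ρ' N = L := by rw [hρ']; exact ecsf9093_sideLength_eq hN0 hL
  -- finiteness of the ground-state energy of the box
  have hE₀ : periodicGroundStateEnergy v N L ≠ ⊤ := by
    refine hfin N L hN0 hL ?_
    have h1 : (N : ℝ) ≤ 2 * ρ * L ^ 3 := by
      have h := hhi
      rw [hρ', div_le_iff₀ hL3] at h
      exact h
    have h2 : 2 * ρ * L ^ 3 ≤ ρ₁ * L ^ 3 := mul_le_mul_of_nonneg_right (by linarith) hL3.le
    linarith
  -- the scattering length: `a = 0` makes the window empty
  have ha0 : 0 ≤ (scatteringLength v).toReal := ENNReal.toReal_nonneg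
  rcases ha0.eq_or_lt with ha | ha
  · refine ⟨1, one_pos, fun Ψ _ m hm => ?_⟩
    dsimp only
    intro hk
    exfalso
    rw [← ha, mul_zero, Real.sqrt_zero, mul_zero, ecsf9093_latticeMomentum_eq_sqrt_psq hL] at hk
    have hpos : 0 < Real.sqrt (psq L m) :=
      lt_of_lt_of_le (by positivity) (ecsf9093_two_pi_div_le_sqrt_psq hL hm)
    linarith
  -- `a > 0`: the constants `B = C_I N/(ρ'a)`, `P = (2M₀)² ρ'a`
  have hρ'a : 0 < ρ' * (scatteringLength v).toReal := mul_pos hρ'pos ha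
  obtain ⟨B, hB⟩ : ∃ B : ℝ, B = C_I * N / (ρ' * (scatteringLength v).toReal) := ⟨_, rfl⟩
  have hBpos : 0 < B := by rw [hB]; positivity
  obtain ⟨P, hP⟩ : ∃ P : ℝ, P = (2 * M₀) ^ 2 * (ρ' * (scatteringLength v).toReal) := ⟨_, rfl⟩
  have hPnn : 0 ≤ P := by rw [hP]; positivity
  -- IH at density `ρ'`, read in the box `L`: NM's hypothesis family with constant `B`
  have hIHρ := hIH' ρ' hρ'pos hρ'I N hN0
  simp only [Ineq] at hIHρ
  rw [hside] at hIHρ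
  have hfam : ∀ k : Fin 3 → ℤ, k ≠ 0 → psq L k ≤ P →
      ∀ (t : ℝ) (Ψ : PeriodicTrialState N L), periodicEnergy v Ψ ≠ ⊤ →
        (periodicGroundStateEnergy v N L).toReal - B * t ^ 2 ≤
          (periodicEnergy v Ψ).toReal + t * cosMean L k Ψ := by
    intro k hk hkP t Ψ hΨ
    have h := hIHρ k hk (hkP.trans_eq hP) t Ψ hΨ
    have hle : C_I * t ^ 2 * N / max (ρ' * (scatteringLength v).toReal) (psq L k) ≤ B * t ^ 2 :=
      calc C_I * t ^ 2 * N / max (ρ' * (scatteringLength v).toReal) (psq L k)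
          ≤ C_I * t ^ 2 * N / (ρ' * (scatteringLength v).toReal) :=
            div_le_div_of_nonneg_left (by positivity) hρ'a (le_max_left _ _)
        _ = B * t ^ 2 := by rw [hB]; ring
    linarith
  -- NM with `ε₀ = (2π/L) √(B N)`
  obtain ⟨ε₀, hε₀⟩ : ∃ ε₀ : ℝ, ε₀ = 2 * Real.pi / L * Real.sqrt (B * N) := ⟨_, rfl⟩
  have hε₀pos : 0 < ε₀ := by rw [hε₀]; positivity
  obtain ⟨δ, hδ, hNM'⟩ := hNM v N L hL B P hBpos.le hPnn hE₀ ε₀ hε₀pos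
  refine ⟨ENNReal.ofReal δ, ENNReal.ofReal_pos.mpr hδ, fun Ψ hΨ m hm => ?_⟩
  dsimp only
  intro hk
  rw [ecsf9093_latticeMomentum_eq_sqrt_psq hL] at hk ⊢
  -- the window at density `ρ'` with parameter `2M₀`
  have hPm : 0 < psq L m :=
    Real.sqrt_pos.mp (lt_of_lt_of_le (by positivity) (ecsf9093_two_pi_div_le_sqrt_psq hL hm))
  have hwin : psq L m ≤ P := by
    rw [hP]
    have h1 := pow_le_pow_left₀ (Real.sqrt_nonneg _) hk 2
    rw [Real.sq_sqrt hPm.le, mul_pow, Real.sq_sqrt (by positivity)] at h1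
    have h2 : ρ * (scatteringLength v).toReal ≤ 4 * (ρ' * (scatteringLength v).toReal) := by
      nlinarith
    nlinarith [sq_nonneg M₀]
  -- the COS² moment of `Ψ` and, via the quarter-wavelength translate, its SIN² moment
  have hcosΨ := hNM' m hm hwin (hfam m hm hwin) Ψ hΨ
  obtain ⟨Ψ', hΨ'E, hΨ'eq⟩ := thp_exists_translate_sin_sq hL hm Ψ
  have hΨ' : periodicEnergy v Ψ' ≤ periodicGroundStateEnergy v N L + ENNReal.ofReal δ := by
    rw [hΨ'E v]; exact hΨ
  have hsinΨ := hNM' m hm hwin (hfam m hm hwin) Ψ' hΨ'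
  rw [hΨ'eq] at hsinΨ
  -- `inf_c ≤` the value at `c = 0`, which is the raw second moment `∫(∑cos)²|Ψ|² + ∫(∑sin)²|Ψ|²`
  refine (iInf_le _ (0 : ℂ)).trans ?_
  simp only [sub_zero]
  refine (ecsf9093_lintegral_densityWave_sq_eq m Ψ).trans_le (ENNReal.ofReal_le_ofReal ?_)
  have hΨc := Ψ.contDiff.continuous
  have hcont_cos : Continuous fun X : Config N =>
      (∑ j, Real.cos (2 * Real.pi / L * ∑ i, (m i : ℝ) * X j i)) ^ 2 * ‖Ψ.ψ X‖ ^ 2 := by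
    fun_prop
  have hcont_sin : Continuous fun X : Config N =>
      (∑ j, Real.sin (2 * Real.pi / L * ∑ i, (m i : ℝ) * X j i)) ^ 2 * ‖Ψ.ψ X‖ ^ 2 := by
    fun_prop
  have hsplit : ∫ X in cellN N L, ‖densityWave N L m X‖ ^ 2 * ‖Ψ.ψ X‖ ^ 2 =
      (∫ X in cellN N L, (∑ j, Real.cos (2 * Real.pi / L * ∑ i, (m i : ℝ) * X j i)) ^ 2 * ‖Ψ.ψ X‖ ^ 2) +
        ∫ X in cellN N L, (∑ j, Real.sin (2 * Real.pi / L * ∑ i, (m i : ℝ) * X j i)) ^ 2 *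
          ‖Ψ.ψ X‖ ^ 2 :=
    calc ∫ X in cellN N L, ‖densityWave N L m X‖ ^ 2 * ‖Ψ.ψ X‖ ^ 2
        = ∫ X in cellN N L, ((∑ j, Real.cos (2 * Real.pi / L * ∑ i, (m i : ℝ) * X j i)) ^ 2 *
              ‖Ψ.ψ X‖ ^ 2 +
            (∑ j, Real.sin (2 * Real.pi / L * ∑ i, (m i : ℝ) * X j i)) ^ 2 * ‖Ψ.ψ X‖ ^ 2) := by
          congr 1 with X
          rw [thp_norm_densityWave_sq, add_mul]
      _ = _ := integral_add (integrableOn_cellN hcont_cos L) (integrableOn_cellN hcont_sin L)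
  rw [hsplit]
  -- the bookkeeping: `2 (2R + ε₀) ≤ 6R`, `R = √C_I N |p| / √(ρ'a)`, `√(ρa) ≤ √2 √(ρ'a)`
  have hR : Real.sqrt (B * (N * psq L m)) =
      Real.sqrt C_I * N * Real.sqrt (psq L m) / Real.sqrt (ρ' * (scatteringLength v).toReal) := by
    have hnn : 0 ≤ Real.sqrt C_I * N * Real.sqrt (psq L m) /
        Real.sqrt (ρ' * (scatteringLength v).toReal) := by positivity
    rw [← Real.sqrt_sq hnn]
    congr 1
    rw [div_pow, mul_pow, mul_pow, Real.sq_sqrt hCI.le, Real.sq_sqrt hPm.le, Real.sq_sqrt hρ'a.le,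
      hB]
    field_simp
  have hε₀R : ε₀ ≤ Real.sqrt (B * (N * psq L m)) :=
    calc ε₀ = Real.sqrt (B * N) * (2 * Real.pi / L) := by rw [hε₀]; exact mul_comm _ _
      _ ≤ Real.sqrt (B * N) * Real.sqrt (psq L m) :=
          mul_le_mul_of_nonneg_left (ecsf9093_two_pi_div_le_sqrt_psq hL hm) (Real.sqrt_nonneg _)
      _ = Real.sqrt (B * (N * psq L m)) := by
          rw [← Real.sqrt_mul (by positivity), mul_assoc]
  have hSS' : Real.sqrt (ρ * (scatteringLength v).toReal) ≤
      Real.sqrt 2 * Real.sqrt (ρ' * (scatteringLength v).toReal) := by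
    rw [← Real.sqrt_mul (by norm_num : (0 : ℝ) ≤ 2)]
    exact Real.sqrt_le_sqrt (by nlinarith)
  calc (∫ X in cellN N L, (∑ j, Real.cos (2 * Real.pi / L * ∑ i, (m i : ℝ) * X j i)) ^ 2 * ‖Ψ.ψ X‖ ^ 2) +
        ∫ X in cellN N L, (∑ j, Real.sin (2 * Real.pi / L * ∑ i, (m i : ℝ) * X j i)) ^ 2 * ‖Ψ.ψ X‖ ^ 2
      ≤ (2 * Real.sqrt (B * (N * psq L m)) + ε₀) + (2 * Real.sqrt (B * (N * psq L m)) + ε₀) :=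
        add_le_add hcosΨ hsinΨ
    _ ≤ 6 * Real.sqrt (B * (N * psq L m)) := by linarith
    _ = 6 * (Real.sqrt C_I * N * Real.sqrt (psq L m) / Real.sqrt (ρ' * (scatteringLength v).toReal)) := by
        rw [hR]
    _ ≤ (6 * Real.sqrt (2 * C_I) + 1) * N * Real.sqrt (psq L m) /
          Real.sqrt (ρ * (scatteringLength v).toReal) :=
        thp_arith hNr.le (Real.sqrt_nonneg _) (Real.sqrt_pos.2 (mul_pos hρ ha))
          (Real.sqrt_pos.2 hρ'a) hSS'

end Summit.AtomisticToContinuum.BoseEinsteinCondensation.Cruxes.StaticResponseBound.UvThomsonForceWave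

end
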